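import Mathlib
import Literature.Analysis.FluidPDE.Tao2016AveragedNS.ShiftSetCascadeFlows
import Summits.NavierStokesRegularity.NavierStokesRegularity.Theorems.TaoLadderRungTwoFlatMirrorTableDefs
import Summits.NavierStokesRegularity.NavierStokesRegularity.Theorems.TaoLadderRungTwoFlatMirrorField
import Summits.NavierStokesRegularity.NavierStokesRegularity.Theorems.TaoLadderRungTwoFlatQuadPolarOn
import Summits.NavierStokesRegularity.NavierStokesRegularity.Theorems.TaoLadderRungTwoFlatEnergyFluxPointwise

/-!
# Tao ladder, rung 2♭ — the CO-MOVING DEVIATION ENERGY behind a captured pulse (LADDER §49, junk race L8b)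

Module `…Theorems.TaoLadderRungTwoFlatCoMovingEnergy` (authored by theory-1 g37 as cell file
`harvest-h2-tao-ladder-theory-1/numT49/CoMovingEnergy49.lean`, sha16 6055aa262d7823d6; landed verbatim by p1 g21
`--supports stmt-NavierStokesRegularity-22987`). It types the ALGEBRAIC CORE of the junk-race lemma L8b of SPLIT-T48
(LADDER §47.8, §48.2, §49):

* `deviation_site_identity` — for the graded mirror lattice and ANY families `W` (template) and `u` (deviation),
  `Σᵢ uᵢ,ₙ·(Qᵢ,ₙ(W+u) − Qᵢ,ₙ(W)) = (T_{n−1}(u) − T_n(u)) + Σᵢ uᵢ,ₙ·Lin_W(u)ᵢ,ₙ`: along solutions `X = W + u`, `W`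
  of the same lattice, the deviation's site energy `½|u_n|²` obeys a CONSERVATIVE nearest-neighbour flux law (the
  deviation's own cubic flux `T_n(u) = MirrorPulse.fluxT`) plus a cross term that is LINEAR in the template;
* `cross_term_explicit` — the cross term of the mirror table as an explicit 10-monomial stencil on shells
  `n−1, n, n+1` (each monomial = clock × template value × two deviation values);
* `weighted_amgm`, `weighted_flux_sum` — the exponential-weight AM–GM step: with `φ_{n+1} = e^θ φ_n`,
  `Σ (φ_{n+1} − φ_n)|T_n(X)| ≤ (1+ε)·A·c̄·sinh(θ/2)·Σ (φ_n v_n² + φ_{n+1} a_{n+1}²)`, i.e. the weighted flux is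
  dominated by `2 sinh(θ/2)(1+ε)c̄A` times the weighted energy (species-level pairing: each species counted once);
* `hasDerivAt_comovingWeight` — `d/dt e^{θ(n − (n₀ + σt))} = −σθ·e^{θ(n − (n₀+σt))}` (transport gain of a frame
  moving at `σ` shells per unit time);
* `comovingPulse`, `coMovingEnergyOn` — the template `κΦ` re-indexed to core shell `m` at time `t₀`, and the
  finite-window co-moving energy `V = Σ_{n ∈ s} e^{θ(n − n_e)}·½|u_n|²` (definitions only).

Assembled (desk, LADDER §49.3): for `V(t) = Σ_{n < n_e(t)} e^{θ(n−n_e(t))} ½|u_n(t)|²`, `n_e(t) = core − d₁` moving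
at `σ = κ/τ`,  `dV/dt ≤ −(σθ − 2 sinh(θ/2)(1+ε)c̄A_u − c_×c̄κη̂(d₁))·V + (edge inputs)`, `c_× ≤ 6(1+ε)(1+e^θ)`,
`η̂(d₁)` = pulse amplitude at depth `d₁` behind its core. MODEL toy NUM-T49 (x0E3, ε = ½, λ₀ = 1): `η̂(2) = 1.1e-6`,
per-hop decrement of `V` ∈ [0.66, 0.97]·(θ = 0.7) vs guaranteed ≥ 0.19–0.29, junk amplitude ≤ 0.54 < √(2E_J) = 0.62.

HONEST FRAMING: identities and inequalities about a MODEL lattice (Tao 2016 §4 vocabulary on `S♭`), kernel-checked;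
nothing certified about any orbit; nothing about the Navier–Stokes equations.
-/

-- the sub-problem namespace repeats the summit name by design (D-0017)
set_option linter.dupNamespace false

noncomputable section

namespace Summit.NavierStokesRegularity.NavierStokesRegularity.Theorems

open Literature.Analysis.FluidPDE Literature.Analysis.FluidPDE.TaoCascade

namespace MirrorPulse

/-! ### 1. The deviation's site-energy identity -/

/-- **DEVIATION SITE IDENTITY.** For the graded mirror lattice and any two families `W` (template) and `u`
(deviation): `Σᵢ uᵢ,ₙ·(Q(W+u) − Q(W))ᵢ,ₙ = (T_{n−1}(u) − T_n(u)) + Σᵢ uᵢ,ₙ·Lin_W(u)ᵢ,ₙ`. Along solutions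
`X = W + u` and `W` this is `d/dt ½|u_n|² = T_{n−1}(u) − T_n(u) + (cross term linear in W)`.
[cite: Tao2016AveragedNS, §4 (4.3), (4.8); route TaoLadderRungTwoFlat, transfer lemma L8b (LADDER §49.2)] -/
theorem deviation_site_identity (ε ε₀ : ℝ) (W u : Fin 2 → ℤ → ℝ → ℝ) (n : ℤ) (t : ℝ) :
    ∑ i : Fin 2, u i n t * (quadTermOn shiftSetFlat ε₀ (mirrorTable ε ε) (W + u) i n t
                            - quadTermOn shiftSetFlat ε₀ (mirrorTable ε ε) W i n t)
      = (fluxT ε ε₀ u (n - 1) t - fluxT ε ε₀ u n t)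
        + ∑ i : Fin 2, u i n t * QuadPolar.linTermOn shiftSetFlat ε₀ (mirrorTable ε ε) W u i n t := by
  simp only [Fin.sum_univ_two, Fin.isValue, QuadPolar.quadTermOn_add_eq_lin]
  have h := site_energy_flux ε ε₀ u n t
  linear_combination h

/-- **THE CROSS TERM, EXPLICITLY** (mirror table, species `0 = a`, `1 = v`; template `W = (A, V)`, deviation
`u = (p, q)`): `p_n·Lin_a,n + q_n·Lin_v,n` is the 10-monomial nearest-neighbour stencil below — every monomial is
(clock) × (ONE template value) × (two deviation values on shells `n−1, n, n+1`). Consequence (desk): where the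
template has amplitude `≤ M` the cross term is bounded by `6(1+ε)·c̄·M` times local deviation energies.
[cite: Tao2016AveragedNS, §4 (4.8); route TaoLadderRungTwoFlat, transfer lemma L8b (LADDER §49.2)] -/
theorem cross_term_explicit (ε ε₀ : ℝ) (W u : Fin 2 → ℤ → ℝ → ℝ) (n : ℤ) (t : ℝ) :
    u 0 n t * QuadPolar.linTermOn shiftSetFlat ε₀ (mirrorTable ε ε) W u 0 n t
      + u 1 n t * QuadPolar.linTermOn shiftSetFlat ε₀ (mirrorTable ε ε) W u 1 n t
      = clock ε₀ (n - 1) *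
          (2 * W 1 (n - 1) t * u 0 n t * u 1 (n - 1) t + ε * W 0 n t * u 0 n t * u 1 (n - 1) t
            + ε * W 1 (n - 1) t * u 0 n t ^ 2)
        + clock ε₀ n *
          (-(W 1 n t * u 0 n t * u 1 n t) + ε * W 0 n t * u 0 n t * u 1 n t - ε * W 1 n t * u 0 n t ^ 2
            + W 0 n t * u 1 n t ^ 2 - W 0 (n + 1) t * u 1 n t ^ 2 - W 1 n t * u 0 (n + 1) t * u 1 n t
            - 2 * ε * W 0 (n + 1) t * u 0 (n + 1) t * u 1 n t) := by
  have h0 : QuadPolar.linTermOn shiftSetFlat ε₀ (mirrorTable ε ε) W u 0 n t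
      = quadTermOn shiftSetFlat ε₀ (mirrorTable ε ε) (W + u) 0 n t
        - quadTermOn shiftSetFlat ε₀ (mirrorTable ε ε) W 0 n t - quadTermOn shiftSetFlat ε₀ (mirrorTable ε ε) u 0 n t := by
    have := QuadPolar.quadTermOn_add_eq_lin shiftSetFlat ε₀ (mirrorTable ε ε) W u 0 n t; linarith
  have h1 : QuadPolar.linTermOn shiftSetFlat ε₀ (mirrorTable ε ε) W u 1 n t
      = quadTermOn shiftSetFlat ε₀ (mirrorTable ε ε) (W + u) 1 n t
        - quadTermOn shiftSetFlat ε₀ (mirrorTable ε ε) W 1 n t - quadTermOn shiftSetFlat ε₀ (mirrorTable ε ε) u 1 n t := by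
    have := QuadPolar.quadTermOn_add_eq_lin shiftSetFlat ε₀ (mirrorTable ε ε) W u 1 n t; linarith
  rw [h0, h1]
  simp only [MirrorField.quadTermOn_mirrorTable_carrier, MirrorField.quadTermOn_mirrorTable_bond, Pi.add_apply,
    clock]
  push_cast
  ring

/-! ### 2. The exponential-weight AM–GM step -/

/-- **WEIGHTED AM–GM.** For `0 ≤ θ`: `(e^θ − 1)·|p|·|q| ≤ sinh(θ/2)·(p² + e^θ q²)`; indeed the difference is
`½(e^{θ/2} − e^{−θ/2})·(|p| − e^{θ/2}|q|)² ≥ 0`. (The balanced Young split that turns a weighted nearest-neighbour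
flux into `2 sinh(θ/2)` × weighted energy.) [cite: Tao2016AveragedNS, §4 (4.3); route TaoLadderRungTwoFlat, L8b (LADDER §49.2)] -/
theorem weighted_amgm {θ : ℝ} (hθ : 0 ≤ θ) (p q : ℝ) :
    (Real.exp θ - 1) * (|p| * |q|) ≤ Real.sinh (θ / 2) * (p ^ 2 + Real.exp θ * q ^ 2) := by
  set E : ℝ := Real.exp (θ / 2) with hE
  have hEpos : 0 < E := Real.exp_pos _
  have hE1 : 1 ≤ E := Real.one_le_exp (by linarith)
  have hexp : Real.exp θ = E * E := by
    rw [hE, ← Real.exp_add]; congr 1; ring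
  have hsinh : Real.sinh (θ / 2) = (E - E⁻¹) / 2 := by
    rw [Real.sinh_eq, hE]
    congr 1; congr 1; rw [Real.exp_neg]
  have hEinv : E⁻¹ ≤ E := (inv_le_one_of_one_le₀ hE1).trans hE1
  rw [hexp, hsinh, ← sq_abs p, ← sq_abs q]
  have key : (E - E⁻¹) / 2 * (|p| ^ 2 + E * E * |q| ^ 2) - (E * E - 1) * (|p| * |q|)
      = (E - E⁻¹) / 2 * (|p| - E * |q|) ^ 2 := by
    field_simp
    ring
  have hnn : 0 ≤ (E - E⁻¹) / 2 * (|p| - E * |q|) ^ 2 :=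
    mul_nonneg (div_nonneg (sub_nonneg.mpr hEinv) (by norm_num)) (sq_nonneg _)
  linarith [key, hnn]

/-- **WEIGHTED FLUX SUM.** With weights `φ ≥ 0`, `φ(n+1) = e^θ·φ(n)` (`θ ≥ 0`), amplitudes `|X| ≤ A` and clocks
`≤ c̄` on the finite set `s`: `Σ_{n∈s} (φ(n+1) − φ(n))·|T_n(X)| ≤ (1+ε)·A·c̄·sinh(θ/2)·Σ_{n∈s} (φ(n)·v_n² + φ(n+1)·a_{n+1}²)`
— each species is paired once, so the right side is at most `2 sinh(θ/2)(1+ε)c̄A` times the weighted energy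
`Σ φ_n ½(a_n² + v_n²)` over `s ∪ (s+1)`. [cite: Tao2016AveragedNS, §4 (4.3); route TaoLadderRungTwoFlat, L8b (LADDER §49.2)] -/
theorem weighted_flux_sum {ε ε₀ A θ cbar : ℝ} (hε : 0 ≤ ε) (hε₀ : -1 ≤ ε₀) (hθ : 0 ≤ θ)
    (X : Fin 2 → ℤ → ℝ → ℝ) (t : ℝ) (s : Finset ℤ) (φ : ℤ → ℝ) (hφ : ∀ n, 0 ≤ φ n)
    (hφs : ∀ n, φ (n + 1) = Real.exp θ * φ n) (hbd : ∀ (i : Fin 2) (n : ℤ), |X i n t| ≤ A)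
    (hc : ∀ n ∈ s, clock ε₀ n ≤ cbar) :
    ∑ n ∈ s, (φ (n + 1) - φ n) * |fluxT ε ε₀ X n t|
      ≤ (1 + ε) * A * cbar * Real.sinh (θ / 2) * ∑ n ∈ s, (φ n * X 1 n t ^ 2 + φ (n + 1) * X 0 (n + 1) t ^ 2) := by
  have hA : 0 ≤ A := (abs_nonneg _).trans (hbd 0 0)
  have hsinh : 0 ≤ Real.sinh (θ / 2) := Real.sinh_nonneg_iff.mpr (by linarith)
  rw [Finset.mul_sum]
  refine Finset.sum_le_sum fun n hn => ?_
  have hcn : 0 ≤ clock ε₀ n := by unfold clock; exact Real.rpow_nonneg (by linarith) _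
  have hφn := hφ n
  -- the term: (e^θ − 1) φ_n |T_n| ≤ φ_n · c_n (1+ε) A · (e^θ − 1)|v_n||a_{n+1}| ≤ φ_n c_n (1+ε) A sinh(θ/2)(v_n² + e^θ a_{n+1}²)
  have hT := abs_fluxT_le hε hε₀ X n t (hbd 1 n) (hbd 0 (n + 1))
  have hag := weighted_amgm hθ (X 1 n t) (X 0 (n + 1) t)
  have step1 : (φ (n + 1) - φ n) * |fluxT ε ε₀ X n t|
      ≤ φ n * (clock ε₀ n * ((1 + ε) * A)) * ((Real.exp θ - 1) * (|X 1 n t| * |X 0 (n + 1) t|)) := by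
    rw [hφs n]
    have : (Real.exp θ * φ n - φ n) * |fluxT ε ε₀ X n t| = φ n * (Real.exp θ - 1) * |fluxT ε ε₀ X n t| := by ring
    rw [this]
    have he1 : 0 ≤ Real.exp θ - 1 := by linarith [Real.one_le_exp hθ]
    calc φ n * (Real.exp θ - 1) * |fluxT ε ε₀ X n t|
        ≤ φ n * (Real.exp θ - 1) * (clock ε₀ n * ((1 + ε) * A) * (|X 1 n t| * |X 0 (n + 1) t|)) := by
          exact mul_le_mul_of_nonneg_left hT (mul_nonneg hφn he1)
      _ = φ n * (clock ε₀ n * ((1 + ε) * A)) * ((Real.exp θ - 1) * (|X 1 n t| * |X 0 (n + 1) t|)) := by ring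
  have step2 : φ n * (clock ε₀ n * ((1 + ε) * A)) * ((Real.exp θ - 1) * (|X 1 n t| * |X 0 (n + 1) t|))
      ≤ φ n * (clock ε₀ n * ((1 + ε) * A)) * (Real.sinh (θ / 2) * (X 1 n t ^ 2 + Real.exp θ * X 0 (n + 1) t ^ 2)) := by
    exact mul_le_mul_of_nonneg_left hag (by positivity)
  have step3 : φ n * (clock ε₀ n * ((1 + ε) * A)) * (Real.sinh (θ / 2) * (X 1 n t ^ 2 + Real.exp θ * X 0 (n + 1) t ^ 2))
      ≤ φ n * (cbar * ((1 + ε) * A)) * (Real.sinh (θ / 2) * (X 1 n t ^ 2 + Real.exp θ * X 0 (n + 1) t ^ 2)) := by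
    have h2 : 0 ≤ Real.sinh (θ / 2) * (X 1 n t ^ 2 + Real.exp θ * X 0 (n + 1) t ^ 2) := by positivity
    gcongr
    exact hc n hn
  calc (φ (n + 1) - φ n) * |fluxT ε ε₀ X n t|
      ≤ φ n * (cbar * ((1 + ε) * A)) * (Real.sinh (θ / 2) * (X 1 n t ^ 2 + Real.exp θ * X 0 (n + 1) t ^ 2)) :=
        step1.trans (step2.trans step3)
    _ = (1 + ε) * A * cbar * Real.sinh (θ / 2) * (φ n * X 1 n t ^ 2 + φ (n + 1) * X 0 (n + 1) t ^ 2) := by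
        rw [hφs n]; ring

/-! ### 3. Transport gain of the co-moving frame -/

/-- **CO-MOVING WEIGHT.** `d/dt e^{θ(n − (n₀ + σt))} = −(σθ)·e^{θ(n − (n₀ + σt))}`: in a frame advancing at `σ`
shells per unit time every exponential weight decays at rate `σθ` (the transport side of the junk race).
[cite: Tao2016AveragedNS, §5–§6 (one shell per period); route TaoLadderRungTwoFlat, L8b (LADDER §49.3)] -/
theorem hasDerivAt_comovingWeight (θ σ n₀ : ℝ) (n : ℤ) (t : ℝ) :
    HasDerivAt (fun s => Real.exp (θ * ((n : ℝ) - (n₀ + σ * s))))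
      (-(σ * θ) * Real.exp (θ * ((n : ℝ) - (n₀ + σ * t)))) t := by
  have h1 : HasDerivAt (fun s => θ * ((n : ℝ) - (n₀ + σ * s))) (θ * (-(σ * 1))) t := by
    have h := ((hasDerivAt_id t).const_mul σ).const_add n₀
    have h' := (h.const_sub (n : ℝ)).const_mul θ
    simpa using h'
  have h2 := h1.exp
  convert h2 using 1
  ring

/-! ### 4. Definitions: the co-moving template and the co-moving energy (finite window) -/

/-- The amplitude-`κ` pulse-family member RE-INDEXED so that its core sits at shell `m` at time `t₀`:
`(i,n,t) ↦ κ·Φ_{i,n−m}(κ(t − t₀))`. If `Φ` is shift-periodic with period `τ`, this template advances one shell per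
`τ/κ`, i.e. at `σ = κ/τ` shells per unit time. [cite: Tao2016AveragedNS, §5–§6 (self-similar ansatz); route TaoLadderRungTwoFlat, posited object (L8b template)] -/
def comovingPulse (κ : ℝ) (Φ : Fin 2 → ℤ → ℝ → ℝ) (m : ℤ) (t₀ : ℝ) : Fin 2 → ℤ → ℝ → ℝ :=
  fun i n t => κ * Φ i (n - m) (κ * (t - t₀))

/-- The CO-MOVING DEVIATION ENERGY on a finite set of shells `s` with edge `n_e`:
`V = Σ_{n∈s} e^{θ(n − n_e)}·½(u_{0,n}² + u_{1,n}²)`. (L8b uses `s = ` the shells below `n_e(t) = core(t) − d₁`;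
the infinite version is the `tsum`/limit of these.) [cite: Tao2016AveragedNS, §4 (4.3); route TaoLadderRungTwoFlat, posited object (L8b functional)] -/
def coMovingEnergyOn (s : Finset ℤ) (θ ne : ℝ) (u : Fin 2 → ℤ → ℝ → ℝ) (t : ℝ) : ℝ :=
  ∑ n ∈ s, Real.exp (θ * ((n : ℝ) - ne)) * ((u 0 n t ^ 2 + u 1 n t ^ 2) / 2)

/-- The co-moving energy is nonnegative. [cite: Tao2016AveragedNS, §4 (4.3); route TaoLadderRungTwoFlat, L8b] -/
theorem coMovingEnergyOn_nonneg (s : Finset ℤ) (θ ne : ℝ) (u : Fin 2 → ℤ → ℝ → ℝ) (t : ℝ) :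
    0 ≤ coMovingEnergyOn s θ ne u t := by
  unfold coMovingEnergyOn
  exact Finset.sum_nonneg fun n _ => by positivity

/-- Every shell's deviation is controlled by the co-moving energy with the inverse weight:
`½|u_{i,n}|² ≤ e^{θ(n_e − n)}·V` for `n ∈ s` (how L8b feeds the window estimate behind the edge).
[cite: Tao2016AveragedNS, §4 (4.3); route TaoLadderRungTwoFlat, L8b (LADDER §49.5 interface)] -/
theorem sq_le_exp_mul_coMovingEnergyOn (s : Finset ℤ) (θ ne : ℝ) (u : Fin 2 → ℤ → ℝ → ℝ) (t : ℝ)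
    {n : ℤ} (hn : n ∈ s) (i : Fin 2) :
    u i n t ^ 2 / 2 ≤ Real.exp (θ * (ne - (n : ℝ))) * coMovingEnergyOn s θ ne u t := by
  have hterm : Real.exp (θ * ((n : ℝ) - ne)) * ((u 0 n t ^ 2 + u 1 n t ^ 2) / 2)
      ≤ coMovingEnergyOn s θ ne u t := by
    unfold coMovingEnergyOn
    exact Finset.single_le_sum (f := fun (k : ℤ) => Real.exp (θ * ((k : ℝ) - ne)) * ((u 0 k t ^ 2 + u 1 k t ^ 2) / 2))
      (fun k _ => by positivity) hn
  have hi : u i n t ^ 2 ≤ u 0 n t ^ 2 + u 1 n t ^ 2 := by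
    fin_cases i
    · simp only [Fin.zero_eta, Fin.isValue, le_add_iff_nonneg_right]; positivity
    · simp only [Fin.mk_one, Fin.isValue, le_add_iff_nonneg_left]; positivity
  have hw : Real.exp (θ * (ne - (n : ℝ))) * Real.exp (θ * ((n : ℝ) - ne)) = 1 := by
    rw [← Real.exp_add]; convert Real.exp_zero using 2; ring
  calc u i n t ^ 2 / 2 ≤ (u 0 n t ^ 2 + u 1 n t ^ 2) / 2 := by linarith
    _ = Real.exp (θ * (ne - (n : ℝ))) * (Real.exp (θ * ((n : ℝ) - ne)) * ((u 0 n t ^ 2 + u 1 n t ^ 2) / 2)) := by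
        rw [← mul_assoc, hw, one_mul]
    _ ≤ Real.exp (θ * (ne - (n : ℝ))) * coMovingEnergyOn s θ ne u t :=
        mul_le_mul_of_nonneg_left hterm (Real.exp_pos _).le

end MirrorPulse

end Summit.NavierStokesRegularity.NavierStokesRegularity.Theorems

end
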